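import Summits.Ventures.QEC.Thresholds.ToricCodeSpaceTimeGraph
import HarnessLib

/-!
# An UNCONDITIONAL threshold for the toric code with noisy syndrome measurement, by the
# cluster-counting route on the space-time complex: `p₀ = 1/(4·10⁴)` (LADDER-QEC Q5, kernel tier)

Venture QEC, `Summits/Ventures/QEC/Thresholds/` (qec-lead D1; the phenomenological twin of
`ToricCodeClusterThreshold.lean`). HONEST FRAMING: the DKLP-constant phenomenological instances
(`ToricCodePhenomenologicalThresholds.lean`: `.0101` kernel, `.0111` native, `.0112` conditional) are
CONDITIONAL on the named fact `ToricCode.phenomThreshold_of_sawCountBound` (self-avoiding polygons in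
the space-time lattice, not yet proved). THIS FILE proves a threshold for the SAME model WITHOUT any
named fact, by the Kovalev–Pryadko / Gottesman cluster-counting route on the space-time complex: its
constant is tiny — `p₀ = (2Δ²)⁻²` with `Δ = 10` the degree of the space-time check graph
(`degree_stGraph_le`), i.e. `p₀ = 1/40000 = 2.5·10⁻⁵` — but it is a THEOREM (kernel axioms only): for
every polynomially bounded schedule of rounds `T(L)` and every minimum-weight space-time decoder
family, the failure probability of the `T`-round memory experiment with equal qubit- and
measurement-error rates `q = p` tends to `0` for every `0 ≤ p < 1/40000` (`phenomThreshold_cluster`;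
canonical instance `phenomThreshold_stMinWeight_cluster`; `phenom_accuracyThreshold_ge_cluster`),
with the finite-size bound `Prob_fail ≤ 3L²T · r^L/(100(1-r))`, `r = 200√p`
(`phenomFailureProb_le_cluster`). Inputs, all PROVED in the tree: the space-time model
(`ToricCodePhenomenological.lean`), the projection / distance / degree lemmas
(`ToricCodeSpaceTimeGraph.lean`), the dense-cluster theorem for arbitrary index types
(`exists_denseCluster_of_minWeight_failure'`, `MinWeightDecodingClustersFintype.lean`) and the
cluster-counting bound `sum_hasDenseCluster_le_geometric` (qec-lit-2). No Monte Carlo number here.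

## References

* [DennisEtAl2002] Dennis–Kitaev–Landahl–Preskill, J. Math. Phys. 43 (2002) 4452, §4.2–4.3, §5.2–5.3.
* [Gottesman2014] D. Gottesman, Quantum Inf. Comput. 14 (2014) 1338, §4 Thm. 3 and Thm. 4 (syndrome
  errors: the same cluster argument on the space-time history).
* [KovalevPryadko2013] A. A. Kovalev, L. P. Pryadko, Phys. Rev. A 87 (2013) 020304(R), Thm. 3.
-/

noncomputable section

namespace Summit.Ventures.QEC.Thresholds

open Filter Topology Finset Matrix
open Literature.InformationTheory.QuantumCodes
open Literature.InformationTheory.QuantumCodes.ToricCode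
open Literature.Probability.LatticeModels
open Literature.Probability.RandomPlanarGeometry

namespace PhenomCluster

variable {L T : ℕ}

/-! ### Failure forces a dense space-time cluster -/

/-- **Failure ⟹ dense cluster** on the space-time complex: if a minimum-weight space-time decoder
fails on the history `E` (the residual projection is homologically non-trivial), then the space-time
check graph contains a connected set `S` of `≥ L` links at least half of which are faulty — the generic
dense-cluster theorem with check matrix `stMatrix`, trivial subspace `stHarmless` and distance `L`.
[cite: Gottesman2014, Thm 4 (syndrome errors: the cluster argument on the space-time history)] -/
theorem hasDenseCluster_of_not_corrects [NeZero L] {D : STDecoder L T}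
    (hD : D.IsMinWeight (stSyn L T) (stCycles L T) hammingNorm) {E : History L T}
    (hfail : ¬ D.Corrects (stSyn L T) (stTrivial L T) E) :
    HasDenseCluster (checkGraph (stMatrix L T)) L (supp E) := by
  set E' := D (stSyn L T E) with hE'
  have hsum : stSyn L T (E' + E) = 0 := hD.add_mem E
  have hsyn : stMatrix L T *ᵥ E' = stMatrix L T *ᵥ E := by
    have h : stMatrix L T *ᵥ (E' + E) = 0 := hsum
    rw [Matrix.mulVec_add] at h
    funext x
    have hx := congrFun h x
    simp only [Pi.add_apply, Pi.zero_apply] at hx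
    have key : ∀ a b : ZMod 2, a + b = 0 → a = b := by decide
    exact key _ _ hx
  have hmin : ∀ x : History L T, stMatrix L T *ᵥ x = stMatrix L T *ᵥ E →
      hammingNorm E' ≤ hammingNorm x := by
    intro x hx
    have h := hD.weight_le x
    have hsx : stSyn L T x = stSyn L T E := hx
    rwa [hsx] at h
  have hfail' : E + E' ∉ stHarmless L T := by
    rw [mem_stHarmless_iff, add_comm]
    exact hfail
  obtain ⟨S, hconn, hLS, hhalf⟩ := exists_denseCluster_of_minWeight_failure' (stMatrix L T)
    (stHarmless L T) (fun x hx hxS => le_hammingNorm_of_stCycles hx hxS) hsyn hmin hfail'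
  exact ⟨S, hconn, hLS, hhalf⟩

/-! ### The probabilistic bound and the threshold -/

/-- The number of space-time links: `2L²T` horizontal and `L²T` vertical, `3L²T` in all
("there are altogether `2L²T` horizontal links and `L²T` vertical links on the lattice").
[cite: DennisEtAl2002, §5.3 (2L²T horizontal and L²T vertical links)] -/
theorem card_stLink (L T : ℕ) [NeZero L] : Fintype.card (STLink L T) = 3 * L ^ 2 * T := by
  simp only [Fintype.card_sum, Fintype.card_prod, Fintype.card_fin, Fintype.card_fun, ZMod.card]
  ring

/-- A binary history is determined by its support. [folklore] -/
private theorem supp_injective {V : Type*} [Fintype V] [DecidableEq V] :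
    Function.Injective (supp : (V → ZMod 2) → Finset V) := by
  intro e₁ e₂ h
  funext ℓ
  have h1 : ℓ ∈ supp e₁ ↔ ℓ ∈ supp e₂ := by rw [h]
  simp only [supp, Finset.mem_filter, Finset.mem_univ, true_and] at h1
  have key : ∀ a b : ZMod 2, (a ≠ 0 ↔ b ≠ 0) → a = b := by decide
  exact key _ _ h1

/-- **Finite-size bound by the cluster route, unconditional**: for a minimum-weight space-time decoder
of the `L × L` toric code (`L ≥ 1`) monitored for `T` rounds with equal rates `q = p`, `0 ≤ p ≤ 1` and
`r := 200√p < 1`: `Prob_fail ≤ 3L²T · r^L / (100(1-r))`.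
[cite: Gottesman2014, Thm 4 (rates n (p/p₀)^{d/…} shape)] -/
theorem phenomFailureProb_le_cluster (L T : ℕ) [NeZero L] (hL1 : 1 ≤ L) {D : STDecoder L T}
    (hD : D.IsMinWeight (stSyn L T) (stCycles L T) hammingNorm) {p : ℝ} (hp₀ : 0 ≤ p) (hp₁ : p ≤ 1)
    (hr : 2 * (10 : ℝ) ^ 2 * Real.sqrt p < 1) :
    phenomFailureProb L T D p p ≤ (3 * (L : ℝ) ^ 2 * T) * (2 * (10 : ℝ) ^ 2 * Real.sqrt p) ^ L /
      ((10 : ℝ) ^ 2 * (1 - 2 * (10 : ℝ) ^ 2 * Real.sqrt p)) := by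
  classical
  unfold phenomFailureProb
  set F := univ.filter (fun E : History L T => ¬ D.Corrects (stSyn L T) (stTrivial L T) E) with hF
  have hrw : ∑ E ∈ F, phenomenologicalWeight T p p (supp E) = ∑ S ∈ F.image supp, bernoulliWeight p S := by
    rw [Finset.sum_image fun e₁ _ e₂ _ h => supp_injective h]
    exact Finset.sum_congr rfl fun E _ => phenomenologicalWeight_self T p (supp E)
  rw [hrw]
  have hsub : F.image supp ⊆ univ.filter fun S => HasDenseCluster (checkGraph (stMatrix L T)) L S := by
    intro S hS
    obtain ⟨E, hE, rfl⟩ := Finset.mem_image.1 hS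
    rw [Finset.mem_filter] at hE ⊢
    exact ⟨Finset.mem_univ _, hasDenseCluster_of_not_corrects hD hE.2⟩
  refine (Finset.sum_le_sum_of_subset_of_nonneg hsub fun S _ _ => bernoulliWeight_nonneg hp₀ hp₁ S).trans ?_
  have hΔ : ∀ x, (checkGraph (stMatrix L T)).degree x ≤ 10 := fun x => degree_stGraph_le x
  have h := sum_hasDenseCluster_le_geometric (G := checkGraph (stMatrix L T)) hΔ (by norm_num)
    (isLocallyStochastic_bernoulliWeight hp₀ hp₁) hp₀ hp₁ hL1 (by exact_mod_cast hr)
  rw [card_stLink] at h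
  push_cast at h
  exact h

/-- **UNCONDITIONAL phenomenological threshold for the toric code, cluster route** (tier CERTIFIED,
kernel): for every polynomially bounded schedule of rounds and every family of minimum-weight
space-time decoders, `1/(4·10⁴) = 1/40000` is a lower bound on the accuracy threshold of the
`T`-round memory experiment with equal qubit- and measurement-error rates (`Prob_fail → 0` as
`L → ∞` for every `0 ≤ p < 1/40000`). No named-fact hypothesis, no `native_decide`.
[cite: Gottesman2014, Thm 4 (threshold with syndrome errors, p₀ = (2ze)^{-2} shape, here (2Δ²)^{-2}, Δ = 10)] -/
theorem phenomThreshold_cluster {T : ℕ → ℕ} (hT : IsPolyBounded T)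
    {D : (L : ℕ) → STDecoder (L + 1) (T L)}
    (hD : ∀ L, (D L).IsMinWeight (stSyn (L + 1) (T L)) (stCycles (L + 1) (T L)) hammingNorm) :
    IsThresholdLowerBound (phenomFailureFamily T D) (1 / (4 * (10 : ℝ) ^ 4)) := by
  intro p hp₀ hpp
  have hp₁ : p ≤ 1 := by
    have : 1 / (4 * (10 : ℝ) ^ 4) ≤ 1 := by norm_num
    linarith
  have hr : 2 * (10 : ℝ) ^ 2 * Real.sqrt p < 1 := by
    have := two_mul_sq_mul_sqrt_lt_one (Δ := 10) (by norm_num) (p := p) (by exact_mod_cast hpp)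
    exact_mod_cast this
  set r : ℝ := 2 * (10 : ℝ) ^ 2 * Real.sqrt p with hrdef
  have hr0 : 0 ≤ r := by positivity
  obtain ⟨A, k, hA⟩ := hT
  -- the bound at every size: `3(L+1)² T(L) r^{L+1}/(100(1-r)) ≤ 3 A (L+1)^{k+2} r^{L+1}/(100(1-r))`
  have hbound : ∀ L, phenomFailureFamily T D L p ≤
      3 * A * ((L : ℝ) + 1) ^ (k + 2) * r ^ (L + 1) / ((10 : ℝ) ^ 2 * (1 - r)) := by
    intro L
    have h := phenomFailureProb_le_cluster (L + 1) (T L) (by omega) (hD L) hp₀ hp₁ hr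
    simp only [phenomFailureFamily]
    refine h.trans ?_
    push_cast
    have h1r : 0 < 1 - r := by linarith
    have hTL : (T L : ℝ) ≤ A * ((L : ℝ) + 1) ^ k := hA L
    have hnum : 3 * ((L : ℝ) + 1) ^ 2 * (T L : ℝ) ≤ 3 * A * ((L : ℝ) + 1) ^ (k + 2) := by
      calc 3 * ((L : ℝ) + 1) ^ 2 * (T L : ℝ) ≤ 3 * ((L : ℝ) + 1) ^ 2 * (A * ((L : ℝ) + 1) ^ k) := by
            gcongr
        _ = 3 * A * ((L : ℝ) + 1) ^ (k + 2) := by ring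
    have hden : 0 < (10 : ℝ) ^ 2 * (1 - r) := by positivity
    rw [div_le_div_iff_of_pos_right hden]
    exact mul_le_mul_of_nonneg_right hnum (pow_nonneg hr0 _)
  -- the right-hand side tends to `0`
  have hlim : Tendsto (fun L : ℕ => 3 * A * ((L : ℝ) + 1) ^ (k + 2) * r ^ (L + 1) /
      ((10 : ℝ) ^ 2 * (1 - r))) atTop (𝓝 0) := by
    have habs : |r| < 1 := by rw [abs_of_nonneg hr0]; exact hr
    have h1 : Tendsto (fun n : ℕ => (n : ℝ) ^ (k + 2) * r ^ n) atTop (𝓝 0) :=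
      tendsto_pow_const_mul_const_pow_of_abs_lt_one (k + 2) habs
    have h2 : Tendsto (fun L : ℕ => (((L + 1 : ℕ) : ℝ)) ^ (k + 2) * r ^ (L + 1)) atTop (𝓝 0) :=
      h1.comp (tendsto_add_atTop_nat 1)
    have h3 := (h2.const_mul (3 * A)).div_const ((10 : ℝ) ^ 2 * (1 - r))
    simp only [mul_zero, zero_div] at h3
    refine h3.congr fun L => ?_
    push_cast
    ring
  have hQ : BelowThreshold (fun L (_ : ℝ) =>
      3 * A * ((L : ℝ) + 1) ^ (k + 2) * r ^ (L + 1) / ((10 : ℝ) ^ 2 * (1 - r))) p := hlim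
  exact BelowThreshold.of_le (P := phenomFailureFamily T D) hQ
    (fun L => by
      simp only [phenomFailureFamily, phenomFailureProb]
      exact Finset.sum_nonneg fun E _ => by
        rw [phenomenologicalWeight_self]
        exact bernoulliWeight_nonneg hp₀ hp₁ _)
    hbound

/-- Decimal form of the cluster-route value: `1/(4·10⁴) = 1/40000`. [folklore] -/
theorem one_div_four_mul_ten_pow_four : 1 / (4 * (10 : ℝ) ^ 4) = 1 / 40000 := by norm_num

/-- **`p_c ≥ 1/40000` for the `T`-round memory experiment, unconditional**, for every polynomially
bounded schedule and every minimum-weight space-time decoder family (tier CERTIFIED, kernel).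
[cite: Gottesman2014, Thm 4] -/
theorem phenom_accuracyThreshold_ge_cluster {T : ℕ → ℕ} (hT : IsPolyBounded T)
    {D : (L : ℕ) → STDecoder (L + 1) (T L)}
    (hD : ∀ L, (D L).IsMinWeight (stSyn (L + 1) (T L)) (stCycles (L + 1) (T L)) hammingNorm) :
    (1 / 40000 : ℝ) ≤ accuracyThreshold (phenomFailureFamily T D) := by
  rw [← one_div_four_mul_ten_pow_four]
  exact le_accuracyThreshold (phenomThreshold_cluster hT hD) (by norm_num)

/-- The canonical instance, unconditional: `T(L) = L + 1` rounds and the canonical minimum-weight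
space-time decoders `Decoder.minWeight` — threshold `≥ 1/(4·10⁴)` (tier CERTIFIED, kernel).
[cite: Gottesman2014, Thm 4] -/
theorem phenomThreshold_stMinWeight_cluster :
    IsThresholdLowerBound
      (phenomFailureFamily (fun L => L + 1)
        fun L => Decoder.minWeight (stSyn (L + 1) (L + 1)) hammingNorm)
      (1 / (4 * (10 : ℝ) ^ 4)) :=
  phenomThreshold_cluster isPolyBounded_succ fun L => ToricCode.isMinWeight_stMinWeight (L + 1) (L + 1)

end PhenomCluster

end Summit.Ventures.QEC.Thresholds

end
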